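import Summits.Ventures.CertifiedManyBodySolver.Conjectures.TwistedRingCertificate

/-!
# U = 0 Gaussian saturation: what a moment relaxation can certify at `U = 0` is its section value

HONEST FRAMING: first certified bounds; not a superconductivity verdict; every number certified
or labelled float.  (Venture `CertifiedManyBodySolver`, programme `hubbard-alg`, team M1 seat 4,
structure notes `STRUCTURE-TM1-doped.md` §E⁗, conjectures C-M1D-5 / C-M1D-5′; pre-registered
predictions P-M1D-34…37 (kit j180402), P-M1D-8 file (kit j180699), P-M1D-38a (kit j180904) —
three registrations, 0 MISS, hence typed here per the programme's standing rule.)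

A `U = 0` moment relaxation of the Hubbard chain is seen here only through its *one-body section*:
every feasible pseudo-state `m` has an even one-body sequence `sec m : ℕ → ℝ` on a block of `S`
sites and the objective is the hopping moment `kin m = -4 · sec m 1` (both spins, `t = 1`).
Two ENGINE PROPERTIES are isolated as hypotheses — they are exactly what C-M1D-5′ asserts of the
certsdp box programs whose filled one-body clique spans the widest PSD block (`S = S_psd`):

* `CliqueSound`     — every feasible pseudo-state has a feasible section of the prescribed density
                      (`0 ⪯ T_S(sec m) ⪯ 1`, `sec m 0 = ρ`): the clique's Gram blocks are imposed;
* `GaussianClosed`  — every feasible section of density `ρ` IS the section of some feasible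
                      pseudo-state (C-M1D-5: the quasi-free functional of a section is feasible —
                      its Gram blocks are genuine, it is translation invariant, and the `U = 0`
                      equations of motion are polynomial identities of the section).

Under these two properties the set of certifiable lower bounds of the relaxation coincides with
the set of lower bounds of the section problem (`lowerBounds_iff`): the relaxation certifies
`E¹_[S](2ρ)` and nothing more (SATURATION), whatever else it contains (two-point vectors, bond
clusters, eom rows).  Combined with the primal certificate `twistedSection_feasible` this gives the
unconditional CAP `certified_le_envelope`: at commensurate density `ρ = N/S` no such relaxation
certifies more than `-4·sin(Nπ/S)/(S·sin(π/S)) = -(4/S)·sin(πn/2)/sin(π/S)` (`n = 2ρ`), the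
twisted-ring envelope of C-M1D-4 — strictly above the free-fermion energy for every finite `S`.
-/

namespace Summit.Ventures.CertifiedManyBodySolver.Conjectures

/-- Feasible one-body sections on a block of `S` sites: `0 ⪯ T_S(g) ⪯ 1`. -/
def SectionFeasible (S : ℕ) (g : ℕ → ℝ) : Prop :=
  (toeplitzSection S g).PosSemidef ∧ (1 - toeplitzSection S g).PosSemidef

/-- A `U = 0` moment relaxation seen through its one-body section on `S` sites: a type of feasible
pseudo-states, their sections, and the objective (= hopping moment). -/
structure SectionView (S : ℕ) where
  /-- feasible pseudo-states of the relaxation -/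
  M : Type
  /-- the one-body section of a pseudo-state -/
  sec : M → (ℕ → ℝ)
  /-- the objective value (energy per site at `U = 0`) -/
  kin : M → ℝ
  /-- the objective is the hopping moment `-2t · 2 · g 1` -/
  kin_eq : ∀ m, kin m = -4 * sec m 1

variable {S : ℕ}

/-- ENGINE PROPERTY 1 (clique soundness): the section of every feasible pseudo-state is a feasible
section of density `ρ` per spin. -/
def CliqueSound (P : SectionView S) (ρ : ℝ) : Prop :=
  ∀ m : P.M, SectionFeasible S (P.sec m) ∧ P.sec m 0 = ρ

/-- ENGINE PROPERTY 2 (Gaussian closure, the content of C-M1D-5): every feasible section of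
density `ρ` is realised by a feasible pseudo-state. -/
def GaussianClosed (P : SectionView S) (ρ : ℝ) : Prop :=
  ∀ g : ℕ → ℝ, SectionFeasible S g → g 0 = ρ → ∃ m : P.M, P.sec m = g

/-- `e` is a certified lower bound of the relaxation. -/
def CertifiedBelow (P : SectionView S) (e : ℝ) : Prop := ∀ m : P.M, e ≤ P.kin m

/-- `e` is a lower bound of the section problem at density `ρ`. -/
def SectionBelow (S : ℕ) (ρ e : ℝ) : Prop :=
  ∀ g : ℕ → ℝ, SectionFeasible S g → g 0 = ρ → e ≤ -4 * g 1

/-- Clique soundness alone: every section lower bound is certified (the clique FLOOR, C-M1D-3). -/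
theorem certified_of_sectionBelow (P : SectionView S) {ρ e : ℝ} (hC : CliqueSound P ρ)
    (he : SectionBelow S ρ e) : CertifiedBelow P e := by
  intro m
  rw [P.kin_eq m]
  exact he (P.sec m) (hC m).1 (hC m).2

/-- Gaussian closure alone: every certified bound is a section lower bound (the Gaussian CAP,
C-M1D-5: the relaxation cannot see past its quasi-free feasible points). -/
theorem sectionBelow_of_certified (P : SectionView S) {ρ e : ℝ} (hG : GaussianClosed P ρ)
    (he : CertifiedBelow P e) : SectionBelow S ρ e := by
  intro g hg h0
  obtain ⟨m, hm⟩ := hG g hg h0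
  have := he m
  rw [P.kin_eq m, hm] at this
  exact this

/-- SATURATION (C-M1D-5′ typed): under both engine properties the certifiable lower bounds of the
relaxation are exactly the lower bounds of the section problem — the relaxation's optimal
certificate at `U = 0` is the section value `E¹_[S]`, nothing more and nothing less. -/
theorem lowerBounds_iff (P : SectionView S) {ρ : ℝ} (hC : CliqueSound P ρ)
    (hG : GaussianClosed P ρ) (e : ℝ) : CertifiedBelow P e ↔ SectionBelow S ρ e :=
  ⟨sectionBelow_of_certified P hG, certified_of_sectionBelow P hC⟩

/-- The twisted-ring envelope caps every section lower bound: at density `ρ = N/S` (with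
`2 ≤ S`, `N ≤ S`) any `e` below all feasible sections satisfies
`e ≤ -4 · sin(Nπ/S) / (S · sin(π/S))` — the primal half of C-M1D-4, from
`twistedSection_feasible`. -/
theorem sectionBelow_le_envelope {N : ℕ} (hS : 2 ≤ S) (hN : N ≤ S) {e : ℝ}
    (he : SectionBelow S ((N : ℝ) / S) e) :
    e ≤ -4 * (Real.sin (N * Real.pi / S) / (S * Real.sin (Real.pi / S))) := by
  obtain ⟨hT, hI, h0, h1⟩ := twistedSection_feasible S N hS hN
  have := he (twistedSection S N) ⟨hT, hI⟩ h0
  rw [h1] at this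
  exact this

/-- CAP ON `U = 0` CERTIFICATES (unconditional in the section data, conditional only on Gaussian
closure of the engine): a Gaussian-closed relaxation whose sections live on `S` sites certifies at
density `N/S` per spin no more than the twisted-ring envelope `-4·sin(Nπ/S)/(S·sin(π/S))`; in
particular never the free-fermion value for finite `S`. -/
theorem certified_le_envelope (P : SectionView S) {N : ℕ} (hS : 2 ≤ S) (hN : N ≤ S)
    (hG : GaussianClosed P ((N : ℝ) / S)) {e : ℝ} (he : CertifiedBelow P e) :
    e ≤ -4 * (Real.sin (N * Real.pi / S) / (S * Real.sin (Real.pi / S))) :=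
  sectionBelow_le_envelope hS hN (sectionBelow_of_certified P hG he)

end Summit.Ventures.CertifiedManyBodySolver.Conjectures
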